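import Mathlib
import Summits.Ventures.PercRepro2.TwoSumStep
import Summits.Ventures.PercRepro2.TwoSumCap2

/-!
# The composite count of a 2-sum with a packing-2 piece: the capacitated counts of the doubled base
(seat mine-b, cell pub-perc-repro2; conjectures/MINE-B.md §13.3)

For a base `A₁` with a parallel pair `p₁, p₂` and a piece `A₂` of packing number ≤ 2, the count
`H(i,j)` of the 2-sum on a pattern `(O, Y)` fibres over the piece colourings `γ₂ ⊆ Y₂`; by the
capacity-2 transfer (`kDisj_twoSum₂_iff`) the fibre over `γ₂` is the **capacitated count**
`capH a b` of the doubled base — `a` copies of `p` for red, `b` for blue, `a, b ∈ {0,1,2}` the piece's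
packing levels `lv` of the red and blue right configurations.  So
  `H(i,j) = Σ_{a,b} w(a,b) · capH a b`,  `w(a,b) = #{γ₂ : lv(red) = a, lv(blue) = b}`
(`absH_twoSum₂_eq_sum`), and the capacitated counts assemble into genuine pattern counts of the
doubled base: `capH 0 0 = H(del)`, `capH 1 0 + capH 0 1 = H(p₁ split)`, `capH 1 1 = H(p₁ pinned)`,
`capH 2 0 + capH 0 2 + 2·capH 1 1 = H(both split)`, `capH 2 1 + capH 1 2 = H(p₁ pinned, p₂ split)`,
`capH 2 2 = H(both pinned)` — the identities behind the absorption lemma (TwoSumAbsorb.lean).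
-/

open Finset

namespace Summit.Ventures.PercRepro2

namespace StepZero

open ReimerCube

variable {E₁ E₂ : Type*} [DecidableEq E₁] [DecidableEq E₂]

section Count

variable {A₁ : Finset E₁ → Prop} {A₂ : Finset E₂ → Prop} {p₁ p₂ : E₁}

open Classical

/-- the packing level of the piece on a right configuration: `2` if `A₂` occurs twice disjointly,
`1` if `A₂` holds, else `0` -/
noncomputable def lv (A₂ : Finset E₂ → Prop) (R : Finset E₂) : ℕ :=
  if DOcc A₂ A₂ R then 2 else if A₂ R then 1 else 0

/-- `c` copies of `p`: `∅`, `{p₁}`, `{p₁, p₂}` -/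
def cp (p₁ p₂ : E₁) : ℕ → Finset E₁
  | 0 => ∅
  | 1 => {p₁}
  | _ => {p₁, p₂}

omit [DecidableEq E₂] in
/-- the copies supplied by a right part are `cp` of its level -/
lemma copies₂_eq_cp (R : Finset E₂) :
    copies₂ A₂ p₁ p₂ R = cp p₁ p₂ (lv A₂ R) := by
  unfold copies₂ lv
  by_cases h2 : DOcc A₂ A₂ R
  · have h1 : A₂ R := by
      obtain ⟨K, -, hK, -, -, hAK, -⟩ := h2
      exact hAK _ hK
    simp [h1, h2, cp]
  · by_cases h1 : A₂ R
    · simp [h1, h2, cp]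
    · simp [h1, h2, cp]

omit [DecidableEq E₂] in
/-- the level is at most `2` -/
lemma lv_le_two (A₂ : Finset E₂ → Prop) (R : Finset E₂) : lv A₂ R ≤ 2 := by
  unfold lv; split_ifs <;> omega

/-- the capacitated count of the doubled base: red gets `a` copies of `p`, blue gets `b` -/
noncomputable def capH (A₁ : Finset E₁ → Prop) (p₁ p₂ : E₁) (O₁ Y₁ : Finset E₁) (i j : ℕ) (a b : ℕ) :
    ℕ :=
  (Y₁.powerset.filter (fun γ₁ =>
    kDisj A₁ i (O₁ ∪ (Y₁ \ γ₁) ∪ cp p₁ p₂ a) ∧ ¬ kDisj A₁ (i + 1) (O₁ ∪ (Y₁ \ γ₁) ∪ cp p₁ p₂ a) ∧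
    kDisj A₁ j (O₁ ∪ γ₁ ∪ cp p₁ p₂ b))).card

/-- the weight of a level pair: the number of piece colourings with red level `a` and blue level `b` -/
noncomputable def wt (A₂ : Finset E₂ → Prop) (O₂ Y₂ : Finset E₂) (a b : ℕ) : ℕ :=
  (Y₂.powerset.filter (fun γ₂ => lv A₂ (O₂ ∪ (Y₂ \ γ₂)) = a ∧ lv A₂ (O₂ ∪ γ₂) = b)).card

/-- the capacity-2 left configuration of `O ∪ Z`, `Z` a disjoint sum, when the pair is absent from
the left parts -/
lemma leftCfg₂_union_disjSum (A₂ : Finset E₂ → Prop) (p₁ p₂ : E₁) (O : Finset (E₁ ⊕ E₂))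
    (Z₁ : Finset E₁) (Z₂ : Finset E₂) (hO1 : p₁ ∉ O.toLeft) (hO2 : p₂ ∉ O.toLeft) (hZ1 : p₁ ∉ Z₁)
    (hZ2 : p₂ ∉ Z₁) :
    leftCfg₂ A₂ p₁ p₂ (O ∪ Z₁.disjSum Z₂) = O.toLeft ∪ Z₁ ∪ copies₂ A₂ p₁ p₂ (O.toRight ∪ Z₂) := by
  unfold leftCfg₂
  rw [Finset.toLeft_union, Finset.toRight_union, Finset.toLeft_disjSum, Finset.toRight_disjSum,
    Finset.erase_eq_of_notMem (s := (O.toLeft ∪ Z₁).erase p₁), Finset.erase_eq_of_notMem]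
  · rw [Finset.mem_union, not_or]; exact ⟨hO1, hZ1⟩
  · rw [Finset.mem_erase, not_and_or, Finset.mem_union, not_or]
    exact Or.inr ⟨hO2, hZ2⟩

/-- **the composite count, fibred over the piece and collected by levels**:
`H(i,j)` of the 2-sum is `Σ_{a,b ≤ 2} w(a,b) · capH a b`. -/
theorem absH_twoSum₂_eq_sum (hpar : IsParallel A₁ p₁ p₂) (hA₁ : Incr A₁) (hA₂ : Incr A₂)
    (h₂ : ∀ S, ¬ DOcc A₂ (DOcc A₂ A₂) S) (O Y : Finset (E₁ ⊕ E₂)) (hp1 : Sum.inl p₁ ∉ O ∪ Y)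
    (hp2 : Sum.inl p₂ ∉ O ∪ Y) (i j : ℕ) :
    absH (twoSum (del A₁ p₂) A₂ p₁) O Y i j
      = ∑ ab ∈ (Finset.range 3) ×ˢ (Finset.range 3),
          wt A₂ O.toRight Y.toRight ab.1 ab.2 * capH A₁ p₁ p₂ O.toLeft Y.toLeft i j ab.1 ab.2 := by
  have hO1 : p₁ ∉ O.toLeft := fun h => hp1 (Finset.mem_union_left _ (Finset.mem_toLeft.mp h))
  have hO2 : p₂ ∉ O.toLeft := fun h => hp2 (Finset.mem_union_left _ (Finset.mem_toLeft.mp h))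
  have hY1 : p₁ ∉ Y.toLeft := fun h => hp1 (Finset.mem_union_right _ (Finset.mem_toLeft.mp h))
  have hY2 : p₂ ∉ Y.toLeft := fun h => hp2 (Finset.mem_union_right _ (Finset.mem_toLeft.mp h))
  -- step 1: fibre over `γ₂`
  have step1 : absH (twoSum (del A₁ p₂) A₂ p₁) O Y i j
      = ∑ γ₂ ∈ Y.toRight.powerset, capH A₁ p₁ p₂ O.toLeft Y.toLeft i j
          (lv A₂ (O.toRight ∪ (Y.toRight \ γ₂))) (lv A₂ (O.toRight ∪ γ₂)) := by
    unfold absH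
    rw [card_filter_powerset_sum]
    refine Finset.sum_congr rfl (fun γ₂ _ => ?_)
    unfold capH
    congr 1
    ext γ₁
    rw [Finset.mem_filter, Finset.mem_filter]
    apply and_congr_right
    intro hγ₁
    rw [Finset.mem_powerset] at hγ₁
    have hγ1 : p₁ ∉ γ₁ := fun h => hY1 (hγ₁ h)
    have hγ2 : p₂ ∉ γ₁ := fun h => hY2 (hγ₁ h)
    have hd1 : p₁ ∉ Y.toLeft \ γ₁ := fun h => hY1 (Finset.mem_sdiff.mp h).1
    have hd2 : p₂ ∉ Y.toLeft \ γ₁ := fun h => hY2 (Finset.mem_sdiff.mp h).1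
    have hsd : Y \ γ₁.disjSum γ₂ = (Y.toLeft \ γ₁).disjSum (Y.toRight \ γ₂) := by
      conv_lhs => rw [← Finset.toLeft_disjSum_toRight (u := Y)]
      ext (x | y) <;> simp
    unfold pinK
    rw [kDisj_twoSum₂_iff hpar hA₁ hA₂ h₂, kDisj_twoSum₂_iff hpar hA₁ hA₂ h₂,
      kDisj_twoSum₂_iff hpar hA₁ hA₂ h₂, hsd, leftCfg₂_union_disjSum A₂ p₁ p₂ O _ _ hO1 hO2 hd1 hd2,
      leftCfg₂_union_disjSum A₂ p₁ p₂ O _ _ hO1 hO2 hγ1 hγ2, copies₂_eq_cp, copies₂_eq_cp]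
  -- step 2: collect by levels
  rw [step1]
  rw [← Finset.sum_fiberwise_of_maps_to (s := Y.toRight.powerset)
    (t := (Finset.range 3) ×ˢ (Finset.range 3))
    (g := fun γ₂ => (lv A₂ (O.toRight ∪ (Y.toRight \ γ₂)), lv A₂ (O.toRight ∪ γ₂)))]
  · refine Finset.sum_congr rfl (fun ab _ => ?_)
    unfold wt
    rw [Finset.card_filter, Finset.sum_mul, Finset.sum_filter]
    refine Finset.sum_congr rfl (fun γ₂ _ => ?_)
    by_cases h : (lv A₂ (O.toRight ∪ (Y.toRight \ γ₂)), lv A₂ (O.toRight ∪ γ₂)) = ab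
    · rw [if_pos h, if_pos (Prod.ext_iff.mp h), one_mul, ← h]
    · rw [if_neg h, if_neg (fun h' => h (Prod.ext h'.1 h'.2)), zero_mul]
  · intro γ₂ _
    rw [Finset.mem_product, Finset.mem_range, Finset.mem_range]
    exact ⟨Nat.lt_succ_of_le (lv_le_two _ _), Nat.lt_succ_of_le (lv_le_two _ _)⟩

end Count

end StepZero

end Summit.Ventures.PercRepro2
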